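import Summits.HodgeConjecture.HodgeConjecture.Theorems.TropicalWeilObstructionTropicalHodgeBoundChkCore

/-!
# Crux `TropicalHodgeBound` (stmt-HodgeConjecture-18480), stub 4 — part C2b: bridges between the
# natural-number codes of the checker and the `Fin`-indexed objects

Route `TropicalWeilObstruction` of `HodgeConjecture`, registered line `birth`
(`Cruxes/TropicalHodgeBound/Lines/birth.lean`), stub `stub_rationalHodgeCoordinates`; ingredient (C).

The checker `…ChkCore` computes with octal codes; the coefficient equations (`…Genericity`) speak about
words `Fin 4 → Fin 8`, `entrySign`, `entryIdx`, `idxList`, `signProd` and an alternating integer table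
`y`. This file proves the dictionary: `esN = entrySign`, `evN = varCode ∘ entryIdx` (by `decide` over
`Fin 8 × Fin 8`); equality of the sorted code lists `keyN` is `List.Perm` of the `idxList`s (`varCode` is
injective); `spN = signProd`; and the transport of `y` to increasing representatives — a five-comparator
sorting network (`net`, sign `netSign`) sorts every injective word, `y (net c) d = netSign c · y c d` by
alternation, and (`decide` over `Fin 8⁴`) `net`/`netSign` agree with the checker's `sort4`/`rankL`/`sgnN`
and the table `sortedWords` (`wordOfRank`). Consequently the checker's valuation
`yvOf y (unkN c d) · sgnN c · sgnN d` is `y c d`. No named fact, no sorry.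

References: [Zharkov2020TropicalWeil] I. Zharkov, arXiv:2002.02347, §2.
-/

set_option linter.dupNamespace false

namespace Summit.HodgeConjecture.HodgeConjecture.Theorems.TropicalHodgeBound

open Literature.AlgebraicGeometry.Tropical

namespace Chk

/-! ### Entry signs and variable codes -/

/-- Injective integer code `8 p₁ + p₂` of a free index. [folklore] -/
def varCode (v : weilFreeIndex 4) : ℕ := 8 * (v.1.1 : ℕ) + (v.1.2 : ℕ)

/-- `varCode` is injective. [folklore] -/
theorem varCode_injective : Function.Injective varCode := by
  intro v w h
  unfold varCode at h
  have h1 : (v.1.1 : ℕ) = w.1.1 := by have := v.1.2.isLt; have := w.1.2.isLt; omega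
  have h2 : (v.1.2 : ℕ) = w.1.2 := by have := v.1.2.isLt; have := w.1.2.isLt; omega
  exact Subtype.ext (Prod.ext (Fin.ext h1) (Fin.ext h2))

/-- `esN` computes `entrySign`. [folklore] -/
theorem esN_eq : ∀ α β : Fin (2 * 4), esN α β = entrySign α β := by decide

/-- `evN` computes the code of `entryIdx`. [folklore] -/
theorem evN_eq : ∀ α β : Fin (2 * 4), evN α β = varCode (entryIdx α β) := by decide

/-- `sA m` computes `Fin.succAbove`. [folklore] -/
theorem sA_eq (m : Fin 5) (a : Fin 4) : sA m a = ((m.succAbove a : Fin 5) : ℕ) := by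
  unfold sA Fin.succAbove
  by_cases h : (a : ℕ) < m
  · rw [if_pos h, if_pos (by rw [Fin.lt_def]; simpa using h)]; simp
  · rw [if_neg h, if_neg (by rw [Fin.lt_def]; simpa using h)]; simp

/-- `spN` computes `signProd` (on value functions). [folklore] -/
theorem spN_eq (K c : Fin 4 → Fin (2 * 4)) (Kn cn : ℕ → ℕ) (hK : ∀ a : Fin 4, Kn a = K a)
    (hc : ∀ a : Fin 4, cn a = c a) : spN Kn cn = signProd K c := by
  unfold spN signProd
  have hK0 : Kn 0 = K 0 := hK 0
  have hK1 : Kn 1 = K 1 := hK 1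
  have hK2 : Kn 2 = K 2 := hK 2
  have hK3 : Kn 3 = K 3 := hK 3
  have hc0 : cn 0 = c 0 := hc 0
  have hc1 : cn 1 = c 1 := hc 1
  have hc2 : cn 2 = c 2 := hc 2
  have hc3 : cn 3 = c 3 := hc 3
  rw [hK0, hK1, hK2, hK3, hc0, hc1, hc2, hc3, esN_eq, esN_eq, esN_eq, esN_eq]

/-! ### Sorting four codes: `keyN` equality is permutation of `idxList` -/

/-- `ins x l` is a permutation of `x :: l`. [folklore] -/
theorem ins_perm (x : ℕ) : ∀ l : List ℕ, (ins x l).Perm (x :: l)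
  | [] => by simp [ins]
  | y :: l => by
      unfold ins
      split_ifs
      · exact List.Perm.refl _
      · exact ((ins_perm x l).cons y).trans (List.Perm.swap x y l)

/-- `ins` keeps a `(· ≤ ·)`-sorted list sorted. [folklore] -/
theorem ins_pairwise (x : ℕ) : ∀ l : List ℕ, l.Pairwise (· ≤ ·) → (ins x l).Pairwise (· ≤ ·)
  | [], _ => by simp [ins]
  | y :: l, h => by
      unfold ins
      rw [List.pairwise_cons] at h
      split_ifs with hxy
      · rw [List.pairwise_cons]
        refine ⟨fun z hz => ?_, List.pairwise_cons.mpr h⟩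
        rcases List.mem_cons.mp hz with rfl | hz
        · exact hxy
        · exact le_trans hxy (h.1 z hz)
      · rw [List.pairwise_cons]
        refine ⟨fun z hz => ?_, ins_pairwise x l h.2⟩
        rcases List.mem_cons.mp ((ins_perm x l).mem_iff.mp hz) with h' | h'
        · omega
        · exact h.1 z h'

/-- `sort4 a b c d` is a sorted permutation of `[a, b, c, d]`. [folklore] -/
theorem sort4_perm (a b c d : ℕ) : (sort4 a b c d).Perm [a, b, c, d] := by
  unfold sort4
  refine (ins_perm a _).trans (List.Perm.cons a ((ins_perm b _).trans (List.Perm.cons b (ins_perm c _))))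

/-- `sort4` is sorted. [folklore] -/
theorem sort4_sortedLE (a b c d : ℕ) : (sort4 a b c d).SortedLE := by
  rw [List.sortedLE_iff_pairwise]
  unfold sort4
  exact ins_pairwise _ _ (ins_pairwise _ _ (ins_pairwise _ _ (by simp)))

/-- Two `sort4`s agree iff the underlying lists are permutations of each other. [folklore] -/
theorem sort4_eq_iff (a b c d a' b' c' d' : ℕ) :
    sort4 a b c d = sort4 a' b' c' d' ↔ [a, b, c, d].Perm [a', b', c', d'] := by
  constructor
  · intro h
    exact ((sort4_perm a b c d).symm.trans (h ▸ sort4_perm a' b' c' d'))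
  · intro h
    exact List.Perm.eq_of_sortedLE (sort4_sortedLE _ _ _ _) (sort4_sortedLE _ _ _ _)
      (((sort4_perm a b c d).trans h).trans (sort4_perm a' b' c' d').symm)

/-- The code list of `idxList`. [folklore] -/
theorem map_varCode_idxList (K c : Fin 4 → Fin (2 * 4)) (Kn cn : ℕ → ℕ) (hK : ∀ a : Fin 4, Kn a = K a)
    (hc : ∀ a : Fin 4, cn a = c a) :
    [evN (Kn 0) (cn 0), evN (Kn 1) (cn 1), evN (Kn 2) (cn 2), evN (Kn 3) (cn 3)] =
      (idxList K c).map varCode := by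
  have hK0 : Kn 0 = K 0 := hK 0
  have hK1 : Kn 1 = K 1 := hK 1
  have hK2 : Kn 2 = K 2 := hK 2
  have hK3 : Kn 3 = K 3 := hK 3
  have hc0 : cn 0 = c 0 := hc 0
  have hc1 : cn 1 = c 1 := hc 1
  have hc2 : cn 2 = c 2 := hc 2
  have hc3 : cn 3 = c 3 := hc 3
  rw [hK0, hK1, hK2, hK3, hc0, hc1, hc2, hc3, evN_eq, evN_eq, evN_eq, evN_eq]; rfl

/-- **Key bridge**: equality of the checker's sorted code lists is permutation-equivalence of the
`idxList`s (equality of monomials). [folklore] -/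
theorem keyN_eq_iff (K c K' c' : Fin 4 → Fin (2 * 4)) (Kn cn Kn' cn' : ℕ → ℕ)
    (hK : ∀ a : Fin 4, Kn a = K a) (hc : ∀ a : Fin 4, cn a = c a)
    (hK' : ∀ a : Fin 4, Kn' a = K' a) (hc' : ∀ a : Fin 4, cn' a = c' a) :
    keyN Kn cn = keyN Kn' cn' ↔ (idxList K c).Perm (idxList K' c') := by
  unfold keyN
  rw [sort4_eq_iff, map_varCode_idxList K c Kn cn hK hc, map_varCode_idxList K' c' Kn' cn' hK' hc',
    List.map_perm_map_iff varCode_injective]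

/-- Membership in `keyN`: each of the four codes belongs to it. [folklore] -/
theorem evN_mem_keyN (Kn cn : ℕ → ℕ) (j : Fin 4) : evN (Kn j) (cn j) ∈ keyN Kn cn := by
  unfold keyN
  rw [(sort4_perm _ _ _ _).mem_iff]
  fin_cases j <;> simp

/-! ### Increasing representatives: the sorting network -/

/-- One comparator: swap positions `i, j` (`i < j`) if out of order. [folklore] -/
def cs (i j : Fin 4) (c : Fin 4 → Fin (2 * 4)) : Fin 4 → Fin (2 * 4) :=
  if c j < c i then c ∘ Equiv.swap i j else c

/-- The sign of one comparator. [folklore] -/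
def csSign (i j : Fin 4) (c : Fin 4 → Fin (2 * 4)) : ℤ := if c j < c i then -1 else 1

/-- The five-comparator sorting network on four positions. [folklore] -/
def net (c : Fin 4 → Fin (2 * 4)) : Fin 4 → Fin (2 * 4) :=
  cs 1 2 (cs 1 3 (cs 0 2 (cs 2 3 (cs 0 1 c))))

/-- The sign of the permutation applied by the network. [folklore] -/
def netSign (c : Fin 4 → Fin (2 * 4)) : ℤ :=
  csSign 0 1 c * csSign 2 3 (cs 0 1 c) * csSign 0 2 (cs 2 3 (cs 0 1 c)) *
    csSign 1 3 (cs 0 2 (cs 2 3 (cs 0 1 c))) * csSign 1 2 (cs 1 3 (cs 0 2 (cs 2 3 (cs 0 1 c))))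

section Transport

variable (y : (Fin 4 → Fin (2 * 4)) → (Fin 4 → Fin (2 * 4)) → ℤ)
  (hy : ∀ (c d : Fin 4 → Fin (2 * 4)) (τ : Equiv.Perm (Fin 4)),
    y (c ∘ τ) d = ((Equiv.Perm.sign τ : ℤˣ) : ℤ) * y c d)
include hy

/-- One comparator multiplies `y` by its sign. [folklore] -/
theorem y_cs (i j : Fin 4) (hij : i ≠ j) (c d : Fin 4 → Fin (2 * 4)) :
    y (cs i j c) d = csSign i j c * y c d := by
  unfold cs csSign
  split_ifs with h
  · rw [hy, Equiv.Perm.sign_swap hij]; simp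
  · simp

/-- The network multiplies `y` by `netSign`. [folklore] -/
theorem y_net (c d : Fin 4 → Fin (2 * 4)) : y (net c) d = netSign c * y c d := by
  unfold net netSign
  rw [y_cs y hy 1 2 (by decide), y_cs y hy 1 3 (by decide), y_cs y hy 0 2 (by decide),
    y_cs y hy 2 3 (by decide), y_cs y hy 0 1 (by decide)]
  ring

end Transport

/-- `netSign` is a sign. [folklore] -/
theorem netSign_mul_self (c : Fin 4 → Fin (2 * 4)) : netSign c * netSign c = 1 := by
  unfold netSign csSign
  split_ifs <;> simp

/-- The increasing word of rank `r` (from the table `sortedWords`). [folklore] -/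
def wordOfRank (r : ℕ) : Fin 4 → Fin (2 * 4) :=
  fun i => ⟨((sortedWords.getD r []).getD i 0) % 8, Nat.mod_lt _ (by decide)⟩

/-- **Decided bridge** between the checker's sorting (`sort4`, `rankL`, `sgnN`, table `sortedWords`) and
the network, for all words with distinct letters. [folklore] -/
theorem sort_bridge : ∀ p q r s : Fin (2 * 4), (p ≠ q ∧ p ≠ r ∧ p ≠ s ∧ q ≠ r ∧ q ≠ s ∧ r ≠ s) →
    wordOfRank (rankL (sort4 p q r s)) = net ![p, q, r, s] ∧
      sgnN (fn4 p q r s) = netSign ![p, q, r, s] ∧ rankL (sort4 p q r s) < 70 := by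
  decide

/-- A word is the `vecCons` of its values. [folklore] -/
theorem word_eta (c : Fin 4 → Fin (2 * 4)) : c = ![c 0, c 1, c 2, c 3] := by
  funext i; fin_cases i <;> rfl

/-- The checker's valuation of the unknown codes by the table `y`. [folklore] -/
def yvOf (y : (Fin 4 → Fin (2 * 4)) → (Fin 4 → Fin (2 * 4)) → ℤ) (u : ℕ) : ℤ :=
  y (wordOfRank (u / 70)) (wordOfRank (u % 70))

/-- **Transport**: for injective words `c, d` (value functions `cn, dn`),
`y c d = sgnN c · sgnN d · yvOf y (unkN c d)`. [folklore] -/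
theorem y_eq_transport (y : (Fin 4 → Fin (2 * 4)) → (Fin 4 → Fin (2 * 4)) → ℤ)
    (hyI : ∀ (c d : Fin 4 → Fin (2 * 4)) (τ : Equiv.Perm (Fin 4)),
      y (c ∘ τ) d = ((Equiv.Perm.sign τ : ℤˣ) : ℤ) * y c d)
    (hyJ : ∀ (c d : Fin 4 → Fin (2 * 4)) (τ : Equiv.Perm (Fin 4)),
      y c (d ∘ τ) = ((Equiv.Perm.sign τ : ℤˣ) : ℤ) * y c d)
    (c d : Fin 4 → Fin (2 * 4)) (cn dn : ℕ → ℕ) (hc : ∀ a : Fin 4, cn a = c a)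
    (hd : ∀ a : Fin 4, dn a = d a) (hci : inj4 cn = true) (hdi : inj4 dn = true) :
    y c d = sgnN cn * sgnN dn * yvOf y (unkN cn dn) := by
  -- injectivity in `Fin` terms
  unfold inj4 at hci hdi
  rw [decide_eq_true_eq] at hci hdi
  have hc0 : cn 0 = c 0 := hc 0
  have hc1 : cn 1 = c 1 := hc 1
  have hc2 : cn 2 = c 2 := hc 2
  have hc3 : cn 3 = c 3 := hc 3
  have hd0 : dn 0 = d 0 := hd 0
  have hd1 : dn 1 = d 1 := hd 1
  have hd2 : dn 2 = d 2 := hd 2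
  have hd3 : dn 3 = d 3 := hd 3
  rw [hc0, hc1, hc2, hc3] at hci
  rw [hd0, hd1, hd2, hd3] at hdi
  have hci' : c 0 ≠ c 1 ∧ c 0 ≠ c 2 ∧ c 0 ≠ c 3 ∧ c 1 ≠ c 2 ∧ c 1 ≠ c 3 ∧ c 2 ≠ c 3 := by
    refine ⟨?_, ?_, ?_, ?_, ?_, ?_⟩ <;> intro h <;> simp_all
  have hdi' : d 0 ≠ d 1 ∧ d 0 ≠ d 2 ∧ d 0 ≠ d 3 ∧ d 1 ≠ d 2 ∧ d 1 ≠ d 3 ∧ d 2 ≠ d 3 := by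
    refine ⟨?_, ?_, ?_, ?_, ?_, ?_⟩ <;> intro h <;> simp_all
  obtain ⟨hcw, hcs, hcr⟩ := sort_bridge (c 0) (c 1) (c 2) (c 3) hci'
  obtain ⟨hdw, hds, hdr⟩ := sort_bridge (d 0) (d 1) (d 2) (d 3) hdi'
  -- the checker's data in terms of `c, d`
  have hsc : sortedL cn = sort4 (c 0) (c 1) (c 2) (c 3) := by
    unfold sortedL; rw [hc0, hc1, hc2, hc3]
  have hsd : sortedL dn = sort4 (d 0) (d 1) (d 2) (d 3) := by
    unfold sortedL; rw [hd0, hd1, hd2, hd3]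
  have hgc : sgnN cn = sgnN (fn4 (c 0) (c 1) (c 2) (c 3)) := by
    unfold sgnN invN fn4; simp only [hc0, hc1, hc2, hc3]; rfl
  have hgd : sgnN dn = sgnN (fn4 (d 0) (d 1) (d 2) (d 3)) := by
    unfold sgnN invN fn4; simp only [hd0, hd1, hd2, hd3]; rfl
  have hu1 : unkN cn dn / 70 = rankL (sort4 (c 0) (c 1) (c 2) (c 3)) := by
    unfold unkN; rw [hsc, hsd]; omega
  have hu2 : unkN cn dn % 70 = rankL (sort4 (d 0) (d 1) (d 2) (d 3)) := by
    unfold unkN; rw [hsc, hsd]; omega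
  unfold yvOf
  rw [hu1, hu2, hcw, hdw, hgc, hgd, hcs, hds, ← word_eta c, ← word_eta d, y_net y hyI]
  -- transport in the second slot: `y c' (net d) = netSign d * y c' d`
  have hy2 : ∀ c' : Fin 4 → Fin (2 * 4), y c' (net d) = netSign d * y c' d := by
    intro c'
    have := y_net (fun d' c'' => y c'' d') (fun d' c'' τ => hyJ c'' d' τ) d c'
    simpa using this
  rw [hy2]
  have h1 := netSign_mul_self c
  have h2 := netSign_mul_self d
  linear_combination (-(y c d * netSign d ^ 2)) * h1 + (-(y c d)) * h2

end Chk

end Summit.HodgeConjecture.HodgeConjecture.Theorems.TropicalHodgeBound
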